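import Mathlib
import Literature.RingTheory.CohomologyAnnihilator.Basic
import Literature.RingTheory.DiscreteValuationRing.DeligneSerreLiftingProofs
import Literature.AlgebraicGeometry.Resolution.NormalSurfaceSingularLocus
import Literature.AlgebraicGeometry.Resolution.NormalizationOfVarieties
import Literature.AlgebraicGeometry.Resolution.RankOneReductionProofs
import Summits.ResolutionOfSingularities.ResolutionOfSingularities.Theorems.SyzygyFlatteningRankOneTerminationStageNormal
import Summits.ResolutionOfSingularities.ResolutionOfSingularities.Theorems.SyzygyFlatteningHigherRankTerminationLocAt
import Summits.ResolutionOfSingularities.ResolutionOfSingularities.Theorems.SyzygyFlatteningHigherRankTerminationTowerStageBasic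
import Summits.ResolutionOfSingularities.ResolutionOfSingularities.Theorems.HomologicalConductorStrictDropRegularDrop
import HarnessLib

/-!
# Crux `StrictDrop` (stmt-ResolutionOfSingularities-16485), line `birth` — stub `stub_dimLEOne_succ_regular`

Route `ResolutionOfSingularities/HomologicalConductor`, stub "dimension `≤ 1` step" (v4) of the
line `birth`: along the canonical normalised `ca`-tower `T₀ = loc A`,
`T_(m+1) = loc (nrm (chart T_m))` of a finitely generated `A ⊆ O ⊆ K = Frac A` (`O` a valuation
ring of `K ⊇ k`), a SINGULAR stage `T_m` of Krull dimension `≤ 1` is followed by a REGULAR stage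
`T_(m+1)`.

## Proof sketch

`T_m` is a noetherian local domain (`Shape`) with `Frac T_m = K` (`A ≤ T_m`), not a field (a
field is a regular local ring), of dimension `≤ 1`. `T_(m+1) = loc (nrm (chart T_m))` is a
noetherian local domain (`Shape`), integrally closed (`isIntegrallyClosed_nrm`,
`isIntegrallyClosed_locAt`), and lies between `T_m` and `K`; by Krull–Akizuki
(`Literature.RingTheory.DiscreteValuationRing.KrullAkizuki_holds`, with `L = K`) it has dimension
`≤ 1`, so it is regular (`isRegularLocalRing_of_isIntegrallyClosed_of_ringKrullDim_le_one`).

The statement is the registered stub with the route's `let`-bound tower inlined verbatim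
(definitionally equal, `Iff.rfl`, to `Sig.stub_dimLEOne_succ_regular` of the line skeleton
`Cruxes/StrictDrop/Lines/birth.lean`, v4).

References: H. Matsumura, *Commutative Ring Theory*, Thm. 11.7 (Krull–Akizuki), Thm. 11.2
[`Matsumura1987`].
-/

noncomputable section

-- single-problem summit: the doubled namespace component is forced
set_option linter.dupNamespace false

namespace Summit.ResolutionOfSingularities.ResolutionOfSingularities.Theorems.StrictDrop.Birth.DimLEOne

open Literature.AlgebraicGeometry.Resolution
  (isRegularLocalRing_of_isIntegrallyClosed_of_ringKrullDim_le_one isFractionRing_subalgebra_of_le)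
open Summit.ResolutionOfSingularities.ResolutionOfSingularities.Theorems.SyzygyFlattening
  (self_le_locAt self_le_nrm isIntegrallyClosed_nrm isIntegrallyClosed_locAt)

variable {k K : Type} [Field k] [Field K] [Algebra k K]

/-! ## Krull–Akizuki for `k`-subalgebras of `K` -/

/-- **Krull–Akizuki for `k`-subalgebras of `K`.** If `T ≤ T'` are `k`-subalgebras of `K` with
`T` noetherian of Krull dimension `≤ 1`, not a field, and `Frac T = K`, then `T'` has Krull
dimension `≤ 1`: `T'` is a `T`-subalgebra of the (trivially finite) extension `K` of
`K = Frac T`, so the Krull–Akizuki theorem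
(`Literature.RingTheory.DiscreteValuationRing.KrullAkizuki_holds`) applies.
[cite: Matsumura1987, Thm. 11.7] -/
theorem ringKrullDim_le_one_of_le (T T' : Subalgebra k K) (h : T ≤ T') [IsNoetherianRing ↥T]
    [IsFractionRing ↥T K] (hdim : ringKrullDim ↥T ≤ 1) (hnf : ¬ IsField ↥T) :
    ringKrullDim ↥T' ≤ 1 := by
  -- adapted from `Literature.AlgebraicGeometry.Resolution.dimensionLEOne_of_le`
  -- (Literature/AlgebraicGeometry/Resolution/QuadraticSequenceDimOneExistence.lean)
  haveI : Ring.DimensionLEOne ↥T :=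
    Literature.AlgebraicGeometry.Resolution.Ring.DimensionLEOne.of_ringKrullDim_le_one hdim
  -- `T'` as a `T`-subalgebra of `K`, and the tautological identification with `T'`
  let B : Subalgebra ↥T K :=
    { T'.toSubsemiring with
      algebraMap_mem' := fun t => h t.2 }
  let e : ↥B ≃+* ↥T' :=
    { toFun := fun x => ⟨x.1, x.2⟩
      invFun := fun x => ⟨x.1, x.2⟩
      left_inv := fun _ => rfl
      right_inv := fun _ => rfl
      map_mul' := fun _ _ => rfl
      map_add' := fun _ _ => rfl }
  obtain ⟨-, hD, -⟩ :=
    Literature.RingTheory.DiscreteValuationRing.KrullAkizuki_holds hnf (K := K) (L := K) B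
  haveI : Ring.DimensionLEOne ↥T' := Ring.DimensionLEOne.of_ringEquiv e.symm
  exact Ring.krullDimLE_iff.mp inferInstance

/-- A `k`-subalgebra of `K` which is a field is a regular local ring. [folklore] -/
theorem isRegularLocalRing_of_isField (T : Subalgebra k K) (hF : IsField ↥T) :
    IsRegularLocalRing ↥T := by
  letI := hF.toField
  infer_instance

/-! ## The stub, in the registered (inlined, `let`-bound) form -/

/-- **Stub `stub_dimLEOne_succ_regular` (dimension-`≤ 1` step, v4) of line `birth` of the crux
`StrictDrop`.** Along the canonical normalised `ca`-tower of `A ⊆ O ⊆ K` whose stages all have the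
tower shape, a singular stage of Krull dimension `≤ 1` is followed by a regular stage (Krull–Akizuki).
[cite: Matsumura1987, Thm. 11.7] -/
theorem stub_dimLEOne_succ_regular : ∀ p : ℕ, p.Prime → ∀ (k K : Type) [Field k] [CharP k p] [Field K] [Algebra k K] (O : ValuationSubring K) (A : Subalgebra k K), (∀ c : k, algebraMap k K c ∈ O) → A.FG → IsFractionRing ↥A K → A.toSubring ≤ O.toSubring → let ca : Subalgebra k K → Set K := fun A => {x : K | ∃ hx : x ∈ A, ∃ n : ℕ, ∀ i : ℕ, n ≤ i → ∀ (M N : ModuleCat.{0} ↥A), Module.Finite ↥A M → Module.Finite ↥A N → ∀ e : CategoryTheory.Abelian.Ext.{0} M N i, (⟨x, hx⟩ : ↥A) • e = 0}; let loc : Subalgebra k K → Subalgebra k K := fun A => Algebra.adjoin k {y : K | ∃ a ∈ A, ∃ s ∈ A, s⁻¹ ∈ O ∧ y = a * s⁻¹}; let chart : Subalgebra k K → Subalgebra k K := fun A => Algebra.adjoin k ((A : Set K) ∪ {y : K | ∃ c ∈ ca A, ∃ x ∈ ca A, x ≠ 0 ∧ (∀ c' ∈ ca A, c' * x⁻¹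 ∈ O) ∧ y = c * x⁻¹}); let nrm : Subalgebra k K → Subalgebra k K := fun B => Algebra.adjoin k {y : K | IsIntegral ↥B y}; let tower : Subalgebra k K → ℕ → Subalgebra k K := fun A m => @Nat.rec (fun _ => Subalgebra k K) (loc A) (fun _ B => loc (nrm (chart B))) m; let Shape : Subalgebra k K → Prop := fun T => (∃ B : Subalgebra k K, B.FG ∧ B ≤ T ∧ loc B = T ∧ ∀ t ∈ T, ∃ b ∈ B, ∃ s ∈ B, s⁻¹ ∈ O ∧ t = b * s⁻¹) ∧ IsNoetherianRing ↥T ∧ T.toSubring ≤ O.toSubring ∧ ∀ s ∈ T, s⁻¹ ∈ O → s⁻¹ ∈ T; (∀ m : ℕ, Shape (tower A m)) → ∀ m : ℕ, ringKrullDim ↥(tower A m) ≤ 1 → ¬ IsRegularLocalRing ↥(tower A m) → IsRegularLocalRing ↥(tower A (m + 1)) := by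
  intro p _ k K _ _ _ _ O A _ _ hfrac _ ca loc chart nrm tower Shape hShape m hdim hsing
  obtain ⟨-, hNoeth, hTO, hunit⟩ := hShape m
  obtain ⟨-, hNoeth', hTO', hunit'⟩ := hShape (m + 1)
  -- every stage contains `A`, so `Frac (tower A m) = K`
  have hAT : ∀ m : ℕ, A ≤ tower A m := by
    intro m
    induction m with
    | zero => exact self_le_locAt O A
    | succ m ih =>
      refine ih.trans fun y hy => ?_
      have hy₁ : y ∈ chart (tower A m) := Algebra.subset_adjoin (Or.inl hy)
      have hy₂ : y ∈ nrm (chart (tower A m)) := self_le_nrm (chart (tower A m)) hy₁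
      exact self_le_locAt O (nrm (chart (tower A m))) hy₂
  haveI := hfrac
  haveI : IsFractionRing ↥(tower A m) K := isFractionRing_subalgebra_of_le A (tower A m) (hAT m)
  -- `T ≤ chart T ≤ nrm (chart T) ≤ loc (nrm (chart T)) = T'`
  have hTc : tower A m ≤ chart (tower A m) := fun y hy => Algebra.subset_adjoin (Or.inl hy)
  have hTT' : tower A m ≤ tower A (m + 1) := fun y hy =>
    self_le_locAt O (nrm (chart (tower A m))) (self_le_nrm (chart (tower A m)) (hTc hy))
  -- the singular stage `T` is a noetherian local domain, not a field
  haveI : IsNoetherianRing ↥(tower A m) := hNoeth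
  have hnf : ¬ IsField ↥(tower A m) := fun hF =>
    hsing (isRegularLocalRing_of_isField (tower A m) hF)
  -- the next stage `T'` is a normal noetherian local domain ...
  haveI : IsNoetherianRing ↥(tower A (m + 1)) := hNoeth'
  haveI : IsLocalRing ↥(tower A (m + 1)) :=
    RegularDrop.isLocalRing_of_le_valuationSubring O (tower A (m + 1)) hTO' hunit'
  haveI : IsFractionRing ↥(chart (tower A m)) K :=
    isFractionRing_subalgebra_of_le A (chart (tower A m)) ((hAT m).trans hTc)
  haveI : IsIntegrallyClosed ↥(nrm (chart (tower A m))) := isIntegrallyClosed_nrm (chart (tower A m))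
  have hNO : (nrm (chart (tower A m))).toSubring ≤ O.toSubring := fun y hy =>
    hTO' (self_le_locAt O (nrm (chart (tower A m))) hy)
  haveI : IsIntegrallyClosed ↥(tower A (m + 1)) :=
    isIntegrallyClosed_locAt O (nrm (chart (tower A m))) hNO
  -- ... of dimension `≤ 1` (Krull–Akizuki), hence regular
  exact isRegularLocalRing_of_isIntegrallyClosed_of_ringKrullDim_le_one ↥(tower A (m + 1))
    (ringKrullDim_le_one_of_le (tower A m) (tower A (m + 1)) hTT' hdim hnf)

end Summit.ResolutionOfSingularities.ResolutionOfSingularities.Theorems.StrictDrop.Birth.DimLEOne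

end
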